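import Summits.MatrixMultiplication.OmegaCensus.STPPNearPeriodAnyGroup

/-!
# ω-census: the cube density law `10k ≤ |G| + 4` in ANY finite group (Kneser-free)

HONEST FRAMING (pub-omega census; verbatim): lottery ticket; floor = certified bounds/negative ranges.
Census STRUCTURE (seat pub-omega-stpp-1 gen 26, 2026-08-27), family (b2), STRUCTURE question Q7.  Nothing here is progress
on `ω`: a necessary condition on simultaneous-TPP families (a tool for EXCLUDING constructions; the pure-cube class never
beats the sum of cubes anyway, `STPP222NeverBeatsAnyGroup.lean`).

## The theorem

For `k` triples of 2-subsets `(Aᵢ, Bᵢ, Cᵢ)_{i<k}` of a finite group `G` with CKSU's simultaneous triple product property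
(Def. 5.1 VERBATIM in an arbitrary group, the tree's `Literature.Combinatorics.Additive.SimultaneousTPP`):
**`10·k ≤ |G| + 4`** (`ten_mul_le_card_add_four_group`).  This is the abelian law of `STPP222DensityTen.lean`
(`CubeNB.ten_mul_le_card_add_four`, proved there with Kneser's theorem) transferred to every finite group, and it sharpens
the group-general packing law `8k ≤ |G| + 2` (`eight_mul_le_card_add_two`) for every `k ≥ 3`.

## Proof

`STPPNearPeriodAnyGroup.lean` §2 (`five_mul_le_two_mul_card_add_group`: `5m ≤ 2|G| + 8`) applied to `X = ⋃ Aᵢ⁻¹Bᵢ`,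
`Y = ⋃ Bᵢ⁻¹Cᵢ`, `Z = ⋃ Aᵢ⁻¹Cᵢ` (`m = 4k`).  §1 below supplies the three local counts from Def. 5.1 in any group (the word
`a a'⁻¹ b b'⁻¹ c c'⁻¹ = 1` read as `(a'⁻¹b)(b'⁻¹c) = a⁻¹c'`): `#Z = Σ|Aᵢ||Cᵢ|` (`card_QU_AC`), `repMul = |B_j| = 2` on `Z` (tree
`repMul_eq_card_B`), and the translate counts `≤ |A_l|`, `≤ |C_l|` (`filter_mul_mem_subset_image_A/_C`).

References: H. Cohn, R. Kleinberg, B. Szegedy, C. Umans, FOCS 2005 (arXiv:math/0511460), Def. 5.1; J. Blasiak, T. Church,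
H. Cohn, J. A. Grochow, E. Naslund, W. F. Sawin, C. Umans, Discrete Analysis 2017:3, §2 (packing injectivity).
-/

open Finset

namespace Summit.MatrixMultiplication.OmegaCensus.CubeNB

variable {G : Type*} [Group G] [DecidableEq G]

/-! ## §1 The STPP interface in any group: the third quotient set and the two translate counts -/

section STPP

open Literature.Combinatorics.Additive

variable {ι : Type*} [Fintype ι] {A B C : ι → Finset G}

/-- `#(⋃ᵢ Aᵢ⁻¹Cᵢ) = Σᵢ |Aᵢ||Cᵢ|` for an STPP family with all `Bᵢ ≠ ∅` (any group): `a⁻¹c = a'⁻¹c'` across blocks `i, i'`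
gives the word `a' a⁻¹ b b⁻¹ c c'⁻¹ = 1` with indices `(i', i, i)`. [cite: BlasiakChurchCohnGrochowNaslundSawinUmans2017, §2] -/
theorem card_QU_AC (h : SimultaneousTPP A B C) (hB : ∀ i, (B i).Nonempty) :
    #(QU A C) = ∑ i, #(A i) * #(C i) := by
  classical
  set D : Finset (Σ _ : ι, G × G) := univ.sigma fun i => A i ×ˢ C i with hD
  have hinj : Set.InjOn (fun x : (Σ _ : ι, G × G) => x.2.1⁻¹ * x.2.2) ↑D := by
    rintro ⟨i, a, c⟩ hx ⟨j, a', c'⟩ hy (he : a⁻¹ * c = a'⁻¹ * c')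
    simp only [hD, coe_sigma, Set.mem_sigma_iff, coe_univ, Set.mem_univ, true_and, coe_product, Set.mem_prod,
      mem_coe] at hx hy
    obtain ⟨b, hb⟩ := hB i
    -- word with indices (j, i, i): a' a⁻¹ b b⁻¹ c c'⁻¹ = 1
    have key : a' * a⁻¹ * b * b⁻¹ * c * c'⁻¹ = 1 := by
      rw [mul_inv_cancel_right, mul_assoc a', he, mul_inv_cancel_left, mul_inv_cancel]
    obtain ⟨rfl, -⟩ := h.2 j i i a' hy.1 a hx.1 b hb b hb c hx.2 c' hy.2 key
    have key' : a' * a⁻¹ * (b * b⁻¹) * (c * c'⁻¹) = 1 := by simpa only [mul_assoc] using key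
    obtain ⟨h1, -, h3⟩ := h.1 _ a' hy.1 a hx.1 b hb b hb c hx.2 c' hy.2 key'
    subst h1 h3
    rfl
  rw [QU, card_image_of_injOn hinj, hD, card_sigma]
  simp only [card_product]

/-- **Translate count, columns (any group).**  For an STPP family and `y = b'⁻¹c ∈ Y_l` (`b' ∈ B_l`, `c ∈ C_l`): the
`x ∈ X = ⋃ᵢ Aᵢ⁻¹Bᵢ` with `x·y ∈ Z = ⋃ⱼ A_j⁻¹C_j` are among `a⁻¹b'`, `a ∈ A_l` (the word forces all indices `= l`, then the TPP of
block `l` forces the `B`-letters to agree). [cite: CohnKleinbergSzegedyUmans2005, Def. 5.1] -/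
theorem filter_mul_mem_subset_image_A (h : SimultaneousTPP A B C) {l : ι} {b' c : G} (hb' : b' ∈ B l) (hc : c ∈ C l) :
    (QU A B).filter (fun x => x * (b'⁻¹ * c) ∈ QU A C) ⊆ (A l).image (fun a => a⁻¹ * b') := by
  intro x hx
  rw [mem_filter] at hx
  obtain ⟨hxX, hxZ⟩ := hx
  obtain ⟨i, a', ha', b, hb, rfl⟩ := mem_QU.1 hxX
  obtain ⟨j, a, ha, c', hc', hz⟩ := mem_QU.1 hxZ
  -- hz : a⁻¹ * c' = a'⁻¹ * b * (b'⁻¹ * c)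
  have key : a * a'⁻¹ * b * b'⁻¹ * c * c'⁻¹ = 1 := by
    have e : a * a'⁻¹ * b * b'⁻¹ * c * c'⁻¹ = a * (a'⁻¹ * b * (b'⁻¹ * c)) * c'⁻¹ := by group
    rw [e, ← hz]; group
  obtain ⟨hji, hil⟩ := h.2 j i l a ha a' ha' b hb b' hb' c hc c' hc' key
  subst hji; subst hil
  have key' : a * a'⁻¹ * (b * b'⁻¹) * (c * c'⁻¹) = 1 := by simpa only [mul_assoc] using key
  obtain ⟨-, hbb, -⟩ := h.1 _ a ha a' ha' b hb b' hb' c hc c' hc' key'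
  subst hbb
  exact mem_image.2 ⟨a', ha', rfl⟩

/-- **Translate count, rows (any group).**  For an STPP family and `x = a'⁻¹b ∈ X_l` (`a' ∈ A_l`, `b ∈ B_l`): the
`y ∈ Y = ⋃ᵢ Bᵢ⁻¹Cᵢ` with `x·y ∈ Z` are among `b⁻¹c`, `c ∈ C_l`. [cite: CohnKleinbergSzegedyUmans2005, Def. 5.1] -/
theorem filter_mul_mem_subset_image_C (h : SimultaneousTPP A B C) {l : ι} {a' b : G} (ha' : a' ∈ A l) (hb : b ∈ B l) :
    (QU B C).filter (fun y => a'⁻¹ * b * y ∈ QU A C) ⊆ (C l).image (fun c => b⁻¹ * c) := by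
  intro y hy
  rw [mem_filter] at hy
  obtain ⟨hyY, hyZ⟩ := hy
  obtain ⟨i, b', hb', c, hc, rfl⟩ := mem_QU.1 hyY
  obtain ⟨j, a, ha, c', hc', hz⟩ := mem_QU.1 hyZ
  -- hz : a⁻¹ * c' = a'⁻¹ * b * (b'⁻¹ * c)
  have key : a * a'⁻¹ * b * b'⁻¹ * c * c'⁻¹ = 1 := by
    have e : a * a'⁻¹ * b * b'⁻¹ * c * c'⁻¹ = a * (a'⁻¹ * b * (b'⁻¹ * c)) * c'⁻¹ := by group
    rw [e, ← hz]; group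
  obtain ⟨hjl, hli⟩ := h.2 j l i a ha a' ha' b hb b' hb' c hc c' hc' key
  subst hjl; subst hli
  have key' : a * a'⁻¹ * (b * b'⁻¹) * (c * c'⁻¹) = 1 := by simpa only [mul_assoc] using key
  obtain ⟨-, hbb, -⟩ := h.1 _ a ha a' ha' b hb b' hb' c hc c' hc' key'
  subst hbb
  exact mem_image.2 ⟨c, hc, rfl⟩

/-- Column count: for `y ∈ Y_l`, at most `|A_l|` elements `x ∈ X` have `x·y ∈ Z`. [cite: CohnKleinbergSzegedyUmans2005, Def. 5.1] -/
theorem card_filter_mul_mem_le_card_A (h : SimultaneousTPP A B C) {l : ι} {y : G}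
    (hy : ∃ b' ∈ B l, ∃ c ∈ C l, b'⁻¹ * c = y) :
    #((QU A B).filter fun x => x * y ∈ QU A C) ≤ #(A l) := by
  obtain ⟨b', hb', c, hc, rfl⟩ := hy
  exact (card_le_card (filter_mul_mem_subset_image_A h hb' hc)).trans card_image_le

/-- Row count: for `x ∈ X_l`, at most `|C_l|` elements `y ∈ Y` have `x·y ∈ Z`. [cite: CohnKleinbergSzegedyUmans2005, Def. 5.1] -/
theorem card_filter_mul_mem_le_card_C (h : SimultaneousTPP A B C) {l : ι} {x : G}
    (hx : ∃ a' ∈ A l, ∃ b ∈ B l, a'⁻¹ * b = x) :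
    #((QU B C).filter fun y => x * y ∈ QU A C) ≤ #(C l) := by
  obtain ⟨a', ha', b, hb, rfl⟩ := hx
  exact (card_le_card (filter_mul_mem_subset_image_C h ha' hb)).trans card_image_le

/-! ## §2 The cube density law in any finite group -/

/-- **THE CUBE DENSITY LAW IN ANY FINITE GROUP.**  If a finite group `G` carries `k` triples of 2-subsets `(Aᵢ, Bᵢ, Cᵢ)` with
CKSU's simultaneous triple product property (Def. 5.1 verbatim, `SimultaneousTPP`), then `10·k ≤ |G| + 4`: `k` simultaneous
`⟨2,2,2⟩` TPP triples fill at most `1/10 + o(1)` of any finite group.  Proof: `five_mul_le_two_mul_card_add_group` applied to `X = ⋃ Aᵢ⁻¹Bᵢ`, `Y = ⋃ Bᵢ⁻¹Cᵢ`,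
`Z = ⋃ Aᵢ⁻¹Cᵢ` (`m = 4k`) with `repMul = |B_j| = 2` on `Z` (`repMul_eq_card_B`) and the translate counts of §1.  The abelian
`IsSTPP` form is `CubeNB.ten_mul_le_card_add_four` (`STPP222DensityTen.lean`); the present proof is Kneser-free.
[cite: CohnKleinbergSzegedyUmans2005, Def. 5.1] -/
theorem ten_mul_le_card_add_four_group [Fintype G] {k : ℕ} {A B C : Fin k → Finset G} (h : SimultaneousTPP A B C)
    (hc : ∀ i, #(A i) = 2 ∧ #(B i) = 2 ∧ #(C i) = 2) : 10 * k ≤ Fintype.card G + 4 := by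
  rcases Nat.eq_zero_or_pos k with hk | hk
  · subst hk; simp
  have hA : ∀ i, (A i).Nonempty := fun i => card_pos.1 (by rw [(hc i).1]; norm_num)
  have hB : ∀ i, (B i).Nonempty := fun i => card_pos.1 (by rw [(hc i).2.1]; norm_num)
  have hC : ∀ i, (C i).Nonempty := fun i => card_pos.1 (by rw [(hc i).2.2]; norm_num)
  have hX : #(QU A B) = 4 * k := by
    rw [card_QU_AB h hC]; simp [hc]; ring
  have hY : #(QU B C) = 4 * k := by
    rw [card_QU_BC h hA]; simp [hc]; ring
  have hZ : #(QU A C) = 4 * k := by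
    rw [card_QU_AC h hB]; simp [hc]; ring
  have hrep : ∀ z ∈ QU A C, repMul (QU A B) (QU B C) z = 2 := by
    intro z hz
    obtain ⟨j, a, ha, c', hc', rfl⟩ := mem_QU.1 hz
    rw [repMul_eq_card_B h ha hc', (hc j).2.1]
  have hcol : ∀ y ∈ QU B C, #((QU A B).filter fun x => x * y ∈ QU A C) ≤ 2 := by
    intro y hy
    obtain ⟨l, b', hb', c, hc'', he⟩ := mem_QU.1 hy
    exact (card_filter_mul_mem_le_card_A h ⟨b', hb', c, hc'', he⟩).trans (hc l).1.le
  have hrow : ∀ x ∈ QU A B, #((QU B C).filter fun y => x * y ∈ QU A C) ≤ 2 := by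
    intro x hx
    obtain ⟨l, a', ha', b, hb, he⟩ := mem_QU.1 hx
    exact (card_filter_mul_mem_le_card_C h ⟨a', ha', b, hb, he⟩).trans (hc l).2.2.le
  have := five_mul_le_two_mul_card_add_group hX hY hZ (by omega) hrep hcol hrow
  omega

/-- Numeric form: `|G| ≥ 10k − 4` (natural subtraction). [cite: CohnKleinbergSzegedyUmans2005, Def. 5.1] -/
theorem ten_mul_sub_four_le_card_group [Fintype G] {k : ℕ} {A B C : Fin k → Finset G} (h : SimultaneousTPP A B C)
    (hc : ∀ i, #(A i) = 2 ∧ #(B i) = 2 ∧ #(C i) = 2) : 10 * k - 4 ≤ Fintype.card G := by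
  have := ten_mul_le_card_add_four_group h hc
  omega

/-- The weaker first rung for the record: `28k ≤ 3|G| + 12` in any finite group (the abelian form is
`CubeNB.twentyeight_mul_le_three_mul_card_add`). [cite: CohnKleinbergSzegedyUmans2005, Def. 5.1] -/
theorem twentyeight_mul_le_three_mul_card_add_group [Fintype G] {k : ℕ} {A B C : Fin k → Finset G}
    (h : SimultaneousTPP A B C) (hc : ∀ i, #(A i) = 2 ∧ #(B i) = 2 ∧ #(C i) = 2) :
    28 * k ≤ 3 * Fintype.card G + 12 := by
  have := ten_mul_le_card_add_four_group h hc
  omega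

end STPP

end Summit.MatrixMultiplication.OmegaCensus.CubeNB
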